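import Literature.Analysis.FluidPDE.TorusNSChaeLeeCriterion
import Literature.Analysis.FluidPDE.TorusNSBerselliCordobaCriterion
import HarnessLib

/-!
# Near-Beltrami depletion with the Farhat–Grujić coupling to the enstrophy rules out blow-up —
# classical solutions on `T³` (continuation form)

Analysis/FluidPDE proof file (theorems only: no definition, no named fact, no `sorry`). Typed for
the NavierStokesRegularity ideation cell (N0 door routes `LocalLambTubeDoor` (S12, born),
`LocalTubeDoorHelicity` (S11) whose `sources:` list arXiv:1804.08238 as nearest prior art): the
GLOBAL periodic analogue of a PUBLISHED local conditional regularity criterion, PROVED in the tree's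
classical periodic vocabulary. Nothing new about regularity.

## What is printed

A. Farhat, Z. Grujić, *Local near-Beltrami structure and depletion of the nonlinearity in the 3D
Navier–Stokes flows*, J. Nonlinear Sci. 29 (2019) 803–812 = arXiv:1804.08238 [FarhatGrujic2018]
(held text `paper:arxiv-1804.08238`, chunks 3–6, read 2026-08-27). §2: the vorticity equation
"in the form suitable for the study of local helicity" `ωₜ − Δω + ∇×(ω × u) = 0` (1); for a
point `(x₀,t₀)`, `r > 0`, a cut-off `ψ = φ(x)η(t)` of the parabolic cylinder `Q_{2r}(x₀,t₀)`,
`α(t) := sup_{x ∈ B(x₀,2r)} sin θ(x,t)`, `θ(x,t) := ∠(ω(x,t), u(x,t))`, and for a (large) `M > 0`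
the high-vorticity sets `S_s = {y : |ω(y,s)| > M} ∩ B(x₀,2r)`:

> **Theorem 1.** Let `u` be a Leray–Hopf solution of the 3D NSE in `ℝ³ × (0,∞)` with initial
> data `u₀ ∈ L²(ℝ³)`. Given `(x₀,t₀) ∈ ℝ³ × (0,∞)` and `r > 0`, suppose that the flow is smooth
> in the open cylinder `Q_{2r}(x₀,t₀)`, up to its parabolic boundary, and assume that there
> exists a constant `c` such that `α(s) ‖∇u(s)‖^{1/2}_{L²(S_s)} ≤ c` for every
> `s ∈ (t₀ − (2r)², t₀)`. Then the localized enstrophy remains bounded in `Q_r(x₀,t₀)`, i.e.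
> `sup_{t ∈ (t₀−r²,t₀)} ∫_{B(x₀,r)} |ω|²(x,t) dx < ∞` and–consequently–`(x₀,t₀)` is a regular
> point.

Printed proof (pp. 4–6): multiply (1) by `ψ²ω`; `∫ ∇×(ω×u)·(ψ²ω) = ∫ ψ(ω×u)·[∇×(ψω)] +
∫ (ω×u)·[∇ψ×(ψω)]` (3)–(4); split `{|ω| ≤ M} ∪ {|ω| > M}`; on the high set
"`|I₂″| ≤ ∫∫ α(s)|u||ψω||∇×(ψω)| ≤ ∫ α(s)‖u‖_{L⁶(S_s)}‖ψω‖_{L³}‖∇(ψω)‖_{L²} ≤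
c∫ α(s)‖∇u‖_{L²(S_s)}‖ψω‖₂^{1/2}‖∇(ψω)‖₂^{3/2}`" ("Hölder's inequality w.r.t. `y`, Sobolev
embedding and Ladyzhenskaya's inequality"), Hölder in `s`, Young, and absorption through
`‖∇u‖_{L²(Q_{2r})} → 0` as `r → 0`. The paper's §1 recalls the global antecedent (H. Beirão da
Veiga, Boll. UMI (9) 5 (2012)): "as long as the sine of the angle between the velocity and the
vorticity is uniformly small with respect to the global enstrophy, the solution remains regular".

## What is typed here, and what is not (faithfulness)

Typed: the **GLOBAL special case `r = ∞`** of Theorem 1 — no cut-off (`ψ ≡ 1`, so the boundary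
terms `I₁, I₃` of (5) vanish), the sets `S_s` and `B(x₀,2r)` both replaced by the whole domain
(so the hypothesis `α(s)‖∇u(s)‖^{1/2}_{L²} ≤ c` becomes STRONGER and the theorem WEAKER than print),
`M = 0` — on the unit torus `T^d`, `card d = 3`, for CLASSICAL solutions of the unforced equations
with mean-zero velocity slices (`Torus.IsClassicalNSSolutionOn`, `ν > 0`), in CONTINUATION FORM at
a putative first blow-up time, exactly as the sibling criteria of this directory
(`TorusNSSerrinCriterion`, `TorusNSBerselliCordobaCriterion`, `TorusNSChaeLeeCriterion`):

* `FarhatGrujic2018.sum_sum_mul_le_of_lambSq_le` — the printed pointwise step on the high set,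
  "`|(ω × u)·∇×(ψω)| ≤ α(s)|u||ψω||∇×(ψω)|`": if `|ω × u|² ≤ a²|u|²|ω|²` (i.e. `sin θ ≤ a` where
  `u, ω ≠ 0`) then `(ω × u)·z ≤ a|u||ω||z|` for every `z` (frame-free: `(ω × u)ᵢ = ∑ⱼ uⱼWⱼᵢ`,
  `W = torusVorticityTensor`, `|ω|² = torusVorticitySqAt`);
* `Torus.classicalNS_continuation_of_lambAngle_majorant` — the mechanism in Prodi–Serrin form:
  a bound `sin θ(·,t) ≤ a(t)` everywhere and a continuous majorant `N(t) ≥ a(t)‖∇u(t)‖₂` with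
  `∫₀ᵗ N⁴ ≤ I` (`t < T`) give continuation past `T` (depletion factor `κ = a(t)|u|`,
  `‖κ(t)‖_{L⁶} ≤ a(t) K₁^{1/6} ‖∇u(t)‖₂` by `H¹ ⊂ L⁶` for mean-zero fields, and the tree's
  geometric Prodi–Serrin door `Torus.classicalNS_continuation_of_lambDepletion_rpow_integral_le`
  at `γ = 6`, `2γ/(γ−3) = 4` — this is the printed chain `α‖u‖_{L⁶}‖ω‖_{L³}‖∇ω‖_{L²}` + Young);
* `Torus.classicalNS_continuation_of_nearBeltrami_enstrophy` — **Theorem 1, global periodic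
  special case**: `sin θ(x,t) ≤ a(t)` for all `x` and `a(t) ‖∇u(t)‖₂^{1/2} ≤ c` for all
  `t ∈ [0,T)` (ANY constant `c ≥ 0`, as printed — no smallness) ⇒ the solution continues to a
  classical mean-zero solution on some `[0,T']`, `T' > T` (majorant `N = c‖∇u‖₂^{1/2}`, whose
  fourth power `c⁴‖∇u‖₂²` has primitive `≤ c⁴‖u(0)‖₂²/(2ν)` by the energy equality
  `Torus.classicalNS_integral_gradNormSq_le`; this Grönwall/energy closure replaces the printed
  absorption through `‖∇u‖_{L²(Q_{2r})} → 0`, which has no global counterpart);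
* `Torus.exists_lambAngle_gt_of_not_bddAbove_gradNormSq` — read at a blow-up time: if the
  enstrophy is unbounded on `[0,T)` then for every `c` the coupled bound fails somewhere.

NOT typed (scope): (i) the LOCAL statement of Theorem 1 itself (parabolic cylinder, Leray–Hopf
class, "regular point" conclusion) — the tree has no localized enstrophy machinery on `ℝ³`
(cf. the fact `grujic2009_localized_halfHolder_coherence`), and the printed localized proof bounds
`‖u‖_{L⁶(S_s)}` by `c‖∇u‖_{L²(S_s)}` on the high-vorticity set `S_s` (p. 5, estimates of `I₂″`
and `I₃″`), a Sobolev inequality on an arbitrary open set that we could not justify as printed (the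
argument goes through with `L²(B(x₀,2r))`-norms of `∇u` and `u` instead, i.e. for a weaker
statement); it is therefore NOT vendored as a named fact; (ii) the threshold `M > 0` (the angle
hypothesis only where `|ω| > M`): in the global setting the low-vorticity part of the Lamb-vector
pairing produces an additive `M²‖u‖₂²` term outside the tree's Grönwall door; (iii) the WHOLE SPACE `ℝ³`
is the sibling file `NearBeltramiEnstrophyCriterion` (`nearBeltrami_enstrophy_criterion`, in the
Constantin–Fefferman frame `constantin_fefferman` / `holderHalf_direction_criterion`, through the
Lamb form of the stretching and the slab Grönwall `integral_sq_norm_curl_le_of_direction_slab`).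
-- TODO(general form): Theorem 1 as printed (local, `Q_{2r}(x₀,t₀)`, threshold `M`).

Relation to the tree: the ORTHOGONAL end `u ⟂ ω` of the same dictionary is the proved
Berselli–Córdoba criterion `Torus.classicalNS_continuation_of_velocity_orthogonal_vorticity`
(FG18 §1: "[BC09] … the flow in this case is 'anti-Beltrami'"); the exact Beltrami end
`ω × u = 0` kills the nonlinearity (`TorusNSBeltramiGlobalStability`); Chae 2010 / Chae–Lee 2017
(`u × ω` in Lorentz / Serrin classes) is `TorusNSChaeLeeCriterion`, whose depletion-factor form is
the door used here.

## Mathlib / tree search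

Tree (used): `Torus.classicalNS_continuation_of_lambDepletion_rpow_integral_le`
(`TorusNSChaeLeeCriterion`), `BerselliCordoba2009.exists_integral_norm_pow_six_le` (`H¹ ⊂ L⁶`,
mean zero), `Torus.IsSmoothSpaceTimeOn.continuousOn_gradNormSq`,
`Torus.classicalNS_integral_gradNormSq_le` (energy equality, `TorusNSFoiasGuillopeTemam`),
`Torus.classicalNS_not_continuation_of_not_bddAbove_gradNormSq'`, `torusVorticityTensor`,
`torusVorticitySqAt(_nonneg)`. Mathlib: `Finset.sum_mul_sq_le_sq_mul_sq`, `EuclideanSpace.norm_eq`,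
`Real.pow_rpow_inv_natCast`, `isCompact_univ.exists_isMaxOn`. Searched (`lean search`):
`Farhat|nearBeltrami|Beltrami.*criterion|lambAngle` — only `BradshawFarhatGrujic2019*` (sparseness)
and the Beltrami EXAMPLE files; no near-Beltrami criterion — added here.

## References

* [FarhatGrujic2018] A. Farhat, Z. Grujić, J. Nonlinear Sci. 29 (2019) 803–812,
  doi:10.1007/s00332-018-9504-8, arXiv:1804.08238 — §2 Theorem 1 (p. 4) and its proof
  (pp. 4–6: (1), (3)–(5), the estimates of `I₂′, I₂″, I₃′, I₃″`); §1 (the global antecedent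
  Beirão da Veiga 2012 and the anti-Beltrami criterion [BC09]).
* [ChaeLee2017] D. Chae, J. Lee, Nonlinear Anal. 151 (2017) 265–273, Thm 1 (ii) at `β = 2`
  (the geometric Prodi–Serrin door, tree file `TorusNSChaeLeeCriterion`).
* [BerselliCordoba2009] L. C. Berselli, D. Córdoba, C. R. Math. Acad. Sci. Paris 347 (2009)
  613–618, Thm 2.1 (the orthogonal end; tree file `TorusNSBerselliCordobaCriterion`).
* [RobinsonRodrigoSadowskiCUP2016] J. C. Robinson, J. L. Rodrigo, W. Sadowski, CUP 2016,
  Lemma 6.11, Thm 1.18 (continuation door and `H¹ ⊂ L⁶`, via the tree files above).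
-/

noncomputable section

open Set MeasureTheory intervalIntegral Filter Real
open scoped InnerProductSpace RealInnerProductSpace Topology ENNReal

namespace Literature.Analysis.FluidPDE

open Literature.Analysis.FunctionSpaces

variable {d : Type*} [Fintype d] [DecidableEq d]

namespace FarhatGrujic2018

/-! ### §1 The pointwise near-Beltrami depletion of the Lamb-vector pairing -/

/-- **The high-set pointwise step of Farhat–Grujić's proof**, "`|[(ψω) × u]·∇×(ψω)| ≤
α(s)|u||ψω||∇×(ψω)|`" (p. 5, estimate of `I₂″`; here `ψ ≡ 1`): on `T^d`, if at a point the Lamb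
vector is depleted, `|ω × v|² ≤ (a|v|)²|ω|²` — frame-free, `(ω × v)ᵢ = ∑ⱼ vⱼ Wⱼᵢ` with
`W = torusVorticityTensor v`, `|ω|² = torusVorticitySqAt v x`; for `v(x), ω(x) ≠ 0` this says
`sin∠(v(x), ω(x)) ≤ a` — then its pairing with any vector `z` is depleted:
`(ω × v)·z ≤ a |v(x)| |ω(x)| ‖z‖` (Cauchy–Schwarz).
[cite: FarhatGrujic2018, Thm 1 (proof, p. 5: the estimate of I₂″, first display)] -/
theorem sum_sum_mul_le_of_lambSq_le (v : UnitAddTorus d → EuclideanSpace ℝ d) (x : UnitAddTorus d)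
    {a : ℝ} (ha : 0 ≤ a)
    (h : ∑ i, (∑ j, v x j * torusVorticityTensor v j i x) ^ 2 ≤
      (a * ‖v x‖) ^ 2 * torusVorticitySqAt v x)
    (z : EuclideanSpace ℝ d) :
    ∑ i, ∑ j, v x j * torusVorticityTensor v j i x * z i ≤
      a * ‖v x‖ * Real.sqrt (torusVorticitySqAt v x) * ‖z‖ := by
  set L : d → ℝ := fun i => ∑ j, v x j * torusVorticityTensor v j i x with hL
  have h1 : ∑ i, ∑ j, v x j * torusVorticityTensor v j i x * z i = ∑ i, L i * z i :=
    Finset.sum_congr rfl fun i _ => by rw [hL, Finset.sum_mul]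
  rw [h1]
  have hS0 : 0 ≤ torusVorticitySqAt v x := torusVorticitySqAt_nonneg v x
  have hz2 : ‖z‖ ^ 2 = ∑ i, z i ^ 2 := by
    rw [EuclideanSpace.norm_eq, Real.sq_sqrt (Finset.sum_nonneg fun i _ => by positivity)]
    exact Finset.sum_congr rfl fun i _ => by rw [Real.norm_eq_abs, sq_abs]
  -- Cauchy–Schwarz in `ℝ^d`, then the hypothesis
  have hcs : (∑ i, L i * z i) ^ 2 ≤ (∑ i, L i ^ 2) * ∑ i, z i ^ 2 :=
    Finset.sum_mul_sq_le_sq_mul_sq _ _ _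
  have hR0 : 0 ≤ a * ‖v x‖ * Real.sqrt (torusVorticitySqAt v x) * ‖z‖ := by positivity
  have hsq : (∑ i, L i * z i) ^ 2 ≤ (a * ‖v x‖ * Real.sqrt (torusVorticitySqAt v x) * ‖z‖) ^ 2 := by
    calc (∑ i, L i * z i) ^ 2 ≤ (∑ i, L i ^ 2) * ∑ i, z i ^ 2 := hcs
      _ ≤ (a * ‖v x‖) ^ 2 * torusVorticitySqAt v x * ∑ i, z i ^ 2 :=
          mul_le_mul_of_nonneg_right h (Finset.sum_nonneg fun i _ => sq_nonneg _)
      _ = (a * ‖v x‖ * Real.sqrt (torusVorticitySqAt v x) * ‖z‖) ^ 2 := by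
          have hsq2 : Real.sqrt (torusVorticitySqAt v x) ^ 2 = torusVorticitySqAt v x :=
            Real.sq_sqrt hS0
          rw [hz2.symm]
          calc (a * ‖v x‖) ^ 2 * torusVorticitySqAt v x * ‖z‖ ^ 2
              = (a * ‖v x‖) ^ 2 * (Real.sqrt (torusVorticitySqAt v x) ^ 2) * ‖z‖ ^ 2 := by
                rw [hsq2]
            _ = (a * ‖v x‖ * Real.sqrt (torusVorticitySqAt v x) * ‖z‖) ^ 2 := by ring
  exact (abs_le_of_sq_le_sq' hsq hR0).2

end FarhatGrujic2018

/-! ### §2 The criteria along classical solutions -/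

section Criterion

variable {ν T : ℝ} {u : ℝ → UnitAddTorus d → EuclideanSpace ℝ d} {p : ℝ → UnitAddTorus d → ℝ}

/-- **Near-Beltrami depletion in Prodi–Serrin form (the mechanism of Farhat–Grujić's Theorem 1,
global periodic case).** Let `(u, p)` be a classical solution of the unforced Navier–Stokes
equations (`ν > 0`) on `[0, T) × T^d`, `card d = 3`, `T > 0`, with mean-zero velocity slices.
Suppose that at every `t ∈ [0, T)` the angle between velocity and vorticity is depleted
EVERYWHERE, `|ω × u|²(x,t) ≤ a(t)² |u(x,t)|² |ω(x,t)|²` for all `x` (i.e. `sin θ(x,t) ≤ a(t)`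
wherever both vectors are non-zero; frame-free with `(ω × u)ᵢ = ∑ⱼ uⱼ Wⱼᵢ`,
`W = torusVorticityTensor (u t)`, `|ω|² = torusVorticitySqAt (u t) x`), `a(t) ≥ 0`, and that a
continuous `N ≥ 0` on `[0, T)` majorises `a(t) ‖∇u(t)‖₂` (`‖∇u(t)‖₂² = Torus.gradNormSq (u t)`)
with `∫₀ᵗ N⁴ ≤ I` for all `t ∈ [0, T)`. Then the solution continues to a classical solution with
mean-zero slices on some `[0, T'] × T^d`, `T' > T`, equal to `u` on `[0, T)` — `T` is not a blow-up
time. Proof (the printed chain "`≤ ∫ α(s)‖u‖_{L⁶}‖ψω‖_{L³}‖∇(ψω)‖_{L²}`", Young, Grönwall, on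
`T³` with `ψ ≡ 1`): the depletion factor `κ(t,x) := a(t)|u(x,t)|` dominates the Lamb pairing
`(ω × u)·Δu ≤ κ|ω||Δu|` (`FarhatGrujic2018.sum_sum_mul_le_of_lambSq_le`), and
`‖κ(t)‖_{L⁶} = a(t)‖u(t)‖_{L⁶} ≤ K₁^{1/6} a(t) ‖∇u(t)‖₂ ≤ K₁^{1/6} N(t)` by the mean-zero
embedding `H¹ ⊂ L⁶` (`BerselliCordoba2009.exists_integral_norm_pow_six_le`); the tree's geometric
Prodi–Serrin door `Torus.classicalNS_continuation_of_lambDepletion_rpow_integral_le` at `γ = 6`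
(`2γ/(γ−3) = 4`) concludes. [cite: FarhatGrujic2018, Thm 1 (proof pp. 5–6: estimate of I₂″ — global periodic special case ψ ≡ 1); ChaeLee2017, Thm 1 (ii) (β = 2, the door)] -/
theorem Torus.classicalNS_continuation_of_lambAngle_majorant (hd : Fintype.card d = 3)
    (hν : 0 < ν) (hT : 0 < T) (h : Torus.IsClassicalNSSolutionOn (Ico 0 T) ν 0 u p)
    (hmean : ∀ t ∈ Ico 0 T, Torus.HasZeroMean (u t)) {a : ℝ → ℝ} (ha : ∀ t ∈ Ico 0 T, 0 ≤ a t)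
    (hangle : ∀ t ∈ Ico 0 T, ∀ x : UnitAddTorus d,
      ∑ i, (∑ j, u t x j * torusVorticityTensor (u t) j i x) ^ 2 ≤
        (a t * ‖u t x‖) ^ 2 * torusVorticitySqAt (u t) x)
    {N : ℝ → ℝ} (hNc : ContinuousOn N (Ico 0 T)) (hN0 : ∀ t ∈ Ico 0 T, 0 ≤ N t)
    (hN : ∀ t ∈ Ico 0 T, a t * Real.sqrt (Torus.gradNormSq (u t)) ≤ N t)
    {I : ℝ} (hI : ∀ t ∈ Ico 0 T, ∫ τ in (0 : ℝ)..t, N τ ^ 4 ≤ I) :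
    ∃ T' : ℝ, T < T' ∧ ∃ (u' : ℝ → UnitAddTorus d → EuclideanSpace ℝ d)
      (p' : ℝ → UnitAddTorus d → ℝ), Torus.IsClassicalNSSolutionOn (Icc 0 T') ν 0 u' p' ∧
        (∀ t ∈ Icc 0 T', Torus.HasZeroMean (u' t)) ∧ ∀ t ∈ Ico 0 T, u' t = u t := by
  obtain ⟨K₁, hK₁0, hK₁⟩ := BerselliCordoba2009.exists_integral_norm_pow_six_le (d := d) hd
  -- the sixth root of the Sobolev constant
  set k : ℝ := K₁ ^ ((6 : ℝ)⁻¹) with hk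
  have hk0 : 0 ≤ k := Real.rpow_nonneg hK₁0 _
  have hk6 : k ^ (6 : ℕ) = K₁ := by
    rw [hk, ← Real.rpow_natCast, ← Real.rpow_mul hK₁0]
    norm_num
  have hs : (3 : ℝ) < 6 := by norm_num
  have hexp : (2 * (6 : ℝ) / (6 - 3)) = ((4 : ℕ) : ℝ) := by norm_num
  refine Torus.classicalNS_continuation_of_lambDepletion_rpow_integral_le hd (s := 6) hν hT hs h
    hmean (κ := fun t x => a t * ‖u t x‖) (fun t ht => ?_) (fun t ht x => ?_) (fun t ht => ?_)
    (fun t ht x => ?_) (N := fun t => k * N t) (continuousOn_const.mul hNc)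
    (fun t ht => mul_nonneg hk0 (hN0 t ht)) (fun t ht => ?_) (I := k ^ 4 * I) (fun t ht => ?_)
  · -- measurability of the depletion factor
    have hut : Torus.IsSmooth (u t) := h.smooth_velocity.isSmooth_slice ht
    exact (continuous_const.mul hut.continuous.norm).aestronglyMeasurable
  · exact mul_nonneg (ha t ht) (norm_nonneg _)
  · -- boundedness on the (compact) torus
    have hut : Torus.IsSmooth (u t) := h.smooth_velocity.isSmooth_slice ht
    obtain ⟨x₀, -, hx₀⟩ :=
      isCompact_univ.exists_isMaxOn univ_nonempty hut.continuous.norm.continuousOn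
    exact ⟨a t * ‖u t x₀‖, fun x => mul_le_mul_of_nonneg_left (hx₀ (mem_univ x)) (ha t ht)⟩
  · -- the pointwise depletion `(ω × u)·Δu ≤ κ |ω| |Δu|`
    exact FarhatGrujic2018.sum_sum_mul_le_of_lambSq_le (u t) x (ha t ht) (hangle t ht x) _
  · -- `‖κ(t)‖_{L⁶} ≤ K₁^{1/6} N(t)`
    have hut : Torus.IsSmooth (u t) := h.smooth_velocity.isSmooth_slice ht
    set G : ℝ := Torus.gradNormSq (u t) with hG
    have hG0 : 0 ≤ G := Torus.gradNormSq_nonneg _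
    have h6 : ∫ x, ‖u t x‖ ^ 6 ≤ K₁ * G ^ 3 := hK₁ (u t) hut (hmean t ht)
    have hX : ∫ x, (a t * ‖u t x‖) ^ (6 : ℝ) = a t ^ 6 * ∫ x, ‖u t x‖ ^ 6 := by
      rw [← MeasureTheory.integral_const_mul]
      refine integral_congr_ae (Eventually.of_forall fun x => ?_)
      simp only
      rw [show (6 : ℝ) = ((6 : ℕ) : ℝ) by norm_num, Real.rpow_natCast, mul_pow]
    have hX0 : 0 ≤ ∫ x, (a t * ‖u t x‖) ^ (6 : ℝ) := by
      rw [hX]; exact mul_nonneg (pow_nonneg (ha t ht) 6) (integral_nonneg fun x => by positivity)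
    -- `∫ κ⁶ ≤ (k N)⁶`
    have hkN0 : 0 ≤ k * N t := mul_nonneg hk0 (hN0 t ht)
    have haG : 0 ≤ a t * Real.sqrt G := mul_nonneg (ha t ht) (Real.sqrt_nonneg _)
    have hle : ∫ x, (a t * ‖u t x‖) ^ (6 : ℝ) ≤ (k * N t) ^ (6 : ℕ) := by
      calc ∫ x, (a t * ‖u t x‖) ^ (6 : ℝ) = a t ^ 6 * ∫ x, ‖u t x‖ ^ 6 := hX
        _ ≤ a t ^ 6 * (K₁ * G ^ 3) := mul_le_mul_of_nonneg_left h6 (pow_nonneg (ha t ht) 6)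
        _ = (k * (a t * Real.sqrt G)) ^ (6 : ℕ) := by
            rw [mul_pow, mul_pow, hk6, show (6 : ℕ) = 2 * 3 from rfl, pow_mul (Real.sqrt G),
              Real.sq_sqrt hG0]
            ring
        _ ≤ (k * N t) ^ (6 : ℕ) :=
            pow_le_pow_left₀ (mul_nonneg hk0 haG) (mul_le_mul_of_nonneg_left (hN t ht) hk0) 6
    -- sixth roots
    have hroot := Real.rpow_le_rpow hX0 hle (by norm_num : (0 : ℝ) ≤ (6 : ℝ)⁻¹)
    have h6 : ((k * N t) ^ (6 : ℕ)) ^ ((6 : ℝ)⁻¹) = k * N t := by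
      have := Real.pow_rpow_inv_natCast hkN0 (by norm_num : (6 : ℕ) ≠ 0)
      simpa using this
    rw [h6] at hroot
    simpa only [one_div] using hroot
  · -- `∫₀ᵗ (k N)⁴ ≤ k⁴ I`
    have hpt : ∀ τ, (k * N τ) ^ (2 * (6 : ℝ) / (6 - 3)) = k ^ 4 * N τ ^ 4 := fun τ => by
      rw [hexp, Real.rpow_natCast, mul_pow]
    simp only [hpt]
    rw [intervalIntegral.integral_const_mul]
    exact mul_le_mul_of_nonneg_left (hI t ht) (pow_nonneg hk0 4)

/-- **Farhat–Grujić 2018, Theorem 1 — global periodic special case, continuation form** (J.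
Nonlinear Sci. 29 (2019), Thm 1: for a Leray–Hopf solution smooth in `Q_{2r}(x₀,t₀)`, "assume that
there exists a constant `c` such that `α(s)‖∇u(s)‖^{1/2}_{L²(S_s)} ≤ c` for every
`s ∈ (t₀ − (2r)², t₀)`", `α(s) = sup_{x ∈ B(x₀,2r)} sin∠(ω(x,s), u(x,s))`, `S_s` the high-vorticity
set; "Then, the localized enstrophy remains bounded in `Q_r(x₀,t₀)` … and–consequently–`(x₀,t₀)`
is a regular point"). Here with `r = ∞` (no cut-off; `S_s` and `B(x₀,2r)` replaced by the whole
torus, `M = 0`), in the tree's classical periodic vocabulary: along a classical solution of the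
unforced equations (`ν > 0`) on `[0, T) × T^d` (`card d = 3`, `T > 0`) with mean-zero velocity
slices, if `a : ℝ → ℝ` is ANY non-negative function with `sin∠(u, ω)(x,t) ≤ a(t)` for all `x`
(as `|ω × u|² ≤ a(t)²|u|²|ω|²`, frame-free, `(ω × u)ᵢ = ∑ⱼ uⱼWⱼᵢ`) and, for some constant `c ≥ 0`
(no smallness required, as printed), `a(t) · ‖∇u(t)‖₂^{1/2} ≤ c` for every `t ∈ [0, T)`
(`‖∇u(t)‖₂^{1/2} = (Torus.gradNormSq (u t))^{1/4}`, written `√(√·)`), then the solution continues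
to a classical mean-zero solution on some `[0, T']`, `T' > T`, equal to `u` on `[0, T)`: the
enstrophy cannot blow up at `T`. Proof: `Torus.classicalNS_continuation_of_lambAngle_majorant`
with the continuous majorant `N(t) = c ‖∇u(t)‖₂^{1/2}` (`Torus.IsSmoothSpaceTimeOn.continuousOn_gradNormSq`),
whose fourth power `c⁴‖∇u(t)‖₂²` has primitive `≤ c⁴ ‖u(0)‖₂²/(2ν)` by the energy equality
(`Torus.classicalNS_integral_gradNormSq_le`). Scope: see the module docstring — the LOCAL printed
statement and the threshold `M` are not typed; every deviation makes this statement weaker than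
print. [cite: FarhatGrujic2018, Thm 1 (p. 4; proof pp. 4–6) — global periodic special case r = ∞, ψ ≡ 1] -/
theorem Torus.classicalNS_continuation_of_nearBeltrami_enstrophy (hd : Fintype.card d = 3)
    (hν : 0 < ν) (hT : 0 < T) (h : Torus.IsClassicalNSSolutionOn (Ico 0 T) ν 0 u p)
    (hmean : ∀ t ∈ Ico 0 T, Torus.HasZeroMean (u t)) {a : ℝ → ℝ} (ha : ∀ t ∈ Ico 0 T, 0 ≤ a t)
    (hangle : ∀ t ∈ Ico 0 T, ∀ x : UnitAddTorus d,
      ∑ i, (∑ j, u t x j * torusVorticityTensor (u t) j i x) ^ 2 ≤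
        (a t * ‖u t x‖) ^ 2 * torusVorticitySqAt (u t) x)
    {c : ℝ} (hc : 0 ≤ c)
    (hcouple : ∀ t ∈ Ico 0 T, a t * Real.sqrt (Real.sqrt (Torus.gradNormSq (u t))) ≤ c) :
    ∃ T' : ℝ, T < T' ∧ ∃ (u' : ℝ → UnitAddTorus d → EuclideanSpace ℝ d)
      (p' : ℝ → UnitAddTorus d → ℝ), Torus.IsClassicalNSSolutionOn (Icc 0 T') ν 0 u' p' ∧
        (∀ t ∈ Icc 0 T', Torus.HasZeroMean (u' t)) ∧ ∀ t ∈ Ico 0 T, u' t = u t := by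
  set G : ℝ → ℝ := fun t => Torus.gradNormSq (u t) with hG
  have hG0 : ∀ t, 0 ≤ G t := fun t => Torus.gradNormSq_nonneg _
  have hGc : ContinuousOn G (Ico 0 T) :=
    h.smooth_velocity.continuousOn_gradNormSq (convex_Ico 0 T) (uniqueDiffOn_Ico 0 T)
  -- the majorant `N = c ‖∇u‖₂^{1/2}`
  set N : ℝ → ℝ := fun t => c * Real.sqrt (Real.sqrt (G t)) with hN
  have hNc : ContinuousOn N (Ico 0 T) := continuousOn_const.mul (hGc.sqrt.sqrt)
  have hN0 : ∀ t ∈ Ico 0 T, 0 ≤ N t := fun t _ => by positivity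
  have hN4 : ∀ τ, N τ ^ 4 = c ^ 4 * G τ := fun τ => by
    have h2 : Real.sqrt (Real.sqrt (G τ)) ^ 4 = G τ := by
      rw [show (4 : ℕ) = 2 * 2 from rfl, pow_mul, Real.sq_sqrt (Real.sqrt_nonneg _),
        Real.sq_sqrt (hG0 τ)]
    rw [hN]; simp only; rw [mul_pow, h2]
  set I : ℝ := c ^ 4 * ((∫ x, ‖u 0 x‖ ^ 2) / (2 * ν)) with hI
  refine Torus.classicalNS_continuation_of_lambAngle_majorant hd hν hT h hmean ha hangle hNc hN0
    (fun t ht => ?_) (I := I) (fun t ht => ?_)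
  · -- `a √G = (a G^{1/4}) G^{1/4} ≤ c G^{1/4}`
    show a t * Real.sqrt (G t) ≤ c * Real.sqrt (Real.sqrt (G t))
    have hs : a t * Real.sqrt (G t) =
        a t * Real.sqrt (Real.sqrt (G t)) * Real.sqrt (Real.sqrt (G t)) := by
      rw [mul_assoc, Real.mul_self_sqrt (Real.sqrt_nonneg _)]
    rw [hs]
    exact mul_le_mul_of_nonneg_right (hcouple t ht) (Real.sqrt_nonneg _)
  · -- the primitive of `N⁴ = c⁴ ‖∇u‖₂²`: energy equality
    simp only [hN4]
    rw [intervalIntegral.integral_const_mul]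
    refine mul_le_mul_of_nonneg_left ?_ (pow_nonneg hc 4)
    rcases ht.1.eq_or_lt with h0 | h0t
    · rw [← h0, intervalIntegral.integral_same]; positivity
    · have hsub : Icc 0 t ⊆ Ico 0 T := fun s hs => ⟨hs.1, hs.2.trans_lt ht.2⟩
      exact Torus.classicalNS_integral_gradNormSq_le hν h0t (h.mono hsub (uniqueDiffOn_Icc h0t))

/-- **Read at a blow-up time** (the printed contrapositive: Theorem 1 bounds the enstrophy, so at
an enstrophy blow-up time the coupled near-Beltrami bound must fail). Along a classical mean-zero
solution of the unforced equations (`ν > 0`) on `[0, T) × T^d` whose enstrophy `‖∇u(t)‖₂²` is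
unbounded on `[0, T)`: for every non-negative angle bound `a` with `|ω × u|² ≤ a(t)²|u|²|ω|²`
everywhere and every constant `c`, there is a time `t ∈ [0, T)` with
`a(t) ‖∇u(t)‖₂^{1/2} > c` (`Torus.classicalNS_not_continuation_of_not_bddAbove_gradNormSq'`).
[cite: FarhatGrujic2018, Thm 1 (contrapositive reading at a singular time; global periodic special case)] -/
theorem Torus.exists_lambAngle_gt_of_not_bddAbove_gradNormSq (hd : Fintype.card d = 3)
    (hν : 0 < ν) (hT : 0 < T) (h : Torus.IsClassicalNSSolutionOn (Ico 0 T) ν 0 u p)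
    (hmean : ∀ t ∈ Ico 0 T, Torus.HasZeroMean (u t))
    (hunb : ¬ BddAbove ((fun t => Torus.gradNormSq (u t)) '' Ico 0 T))
    {a : ℝ → ℝ} (ha : ∀ t ∈ Ico 0 T, 0 ≤ a t)
    (hangle : ∀ t ∈ Ico 0 T, ∀ x : UnitAddTorus d,
      ∑ i, (∑ j, u t x j * torusVorticityTensor (u t) j i x) ^ 2 ≤
        (a t * ‖u t x‖) ^ 2 * torusVorticitySqAt (u t) x)
    {c : ℝ} (hc : 0 ≤ c) :
    ∃ t ∈ Ico 0 T, c < a t * Real.sqrt (Real.sqrt (Torus.gradNormSq (u t))) := by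
  by_contra hcon
  push Not at hcon
  exact Torus.classicalNS_not_continuation_of_not_bddAbove_gradNormSq' hν.le hT h hunb
    (Torus.classicalNS_continuation_of_nearBeltrami_enstrophy hd hν hT h hmean ha hangle hc hcon)

end Criterion

end Literature.Analysis.FluidPDE
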